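import Mathlib
import HarnessLib
import Summits.AtomisticToContinuum.BoseEinsteinCondensation.Theses.BECPopovBerryRG

/-!
# Refutation of `BECPopovBerryRG.BerryStiffPhaseLRO` (stmt-AtomisticToContinuum-14490)

**Repair 2026-08-16:** the route's `restate` (rev 2 `BerryStiffPhaseLROR`, rev 4
`BerryStiffPhaseOS`) dropped the constant `BerryStiffPhaseLRO` from `Theses/BECPopovBerryRG.lean`;
it is re-declared below (original name and definiens), theorem and proof unchanged.
The former route decl `BerryStiffPhaseLRO` (the route's ENGINE at rev 1) asserts, uniformly in
the torus `(ℤ/(m+2))³ × ℤ/(n+2)`, that the weight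
`wt = Σ_F g_F · Π_{bonds avoiding F} B · e^{-Σ_{x ∉ F} w_x}` has `Z = ∫ wt ≠ 0` for EVERY family of
large-field activities `g : Finset sites → (config → ℂ)` subject only to `g ∅ = 1`, locality near
`F` and the cardinality bound `‖g_F‖ ≤ e^{-K |F|}`. Nothing ties `g_F` to `g_{F'}` (no
factorisation over connected components, no sign), so the `2^{#sites}` subsets beat the factor
`e^{-K|F|}` as soon as the volume exceeds `e^{K}`:

* bonds: all four `B(η) = e^{-K(1 - cos η)}` (the cosine XY member: Gaussian core with
  `u = K(η²/2 - 1 + cos η)`, `|u| ≤ (5/96) K η⁴` by `Real.cos_bound`; Peierls floor; `0 < B ≤ 1`),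
  `Kd ≡ K`, `δ = 0`, `Λ = 1`, `R = 0`, remainder `w ≡ 0`;
* activities: `g_∅ = 1`, `g_{x} ≡ -c` on singletons, `g_F = 0` for `|F| ≥ 2`, with
  `c = Z_∅ / Σ_x Ψ_x`, `Ψ_x = ∫ Π_{bonds avoiding x} B`.
Since `0 < B ≤ 1`, deleting the bonds at `x` can only increase the integrand, so `Z_∅ ≤ Ψ_x`,
`Σ_x Ψ_x ≥ V·Z_∅` and `c ≤ 1/V ≤ e^{-K}` once `V = (m+2)³(n+2) ≥ e^{K}` (`m = 0`,
`n = ⌈e^{K}⌉`): the family is admissible and `Z = Z_∅ - c Σ_x Ψ_x = 0`.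

Classification: refuted-misstated. The intended Gawedzki–Kupiainen / Balaban format has
large-field activities that FACTORISE over (`R`-)connected components (a polymer gas), for which
`Z/Z_∅` is a polymer partition function and never vanishes at small activity (Kotecký–Preiss);
repaired statement `C′`: add `g_F = Π_{γ ∈ components F} g_γ` with each `g_γ` local near `γ` and
`‖g_γ‖ ≤ e^{-K|γ|}`. The witness below (independent negative singleton activities, `g_{x,y} = 0 ≠
c²`) does not factorise, so it misses `C′`. [folklore]
-/

noncomputable section

open MeasureTheory Set Finset

namespace Summit.AtomisticToContinuum.BoseEinsteinCondensation.Theorems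

/-- **Record of the replaced route item `BerryStiffPhaseLRO`** = stmt-AtomisticToContinuum-14490
(route BECPopovBerryRG, rev 1 ENGINE; ledger signature verbatim; NOT a route item): re-declared
under its original name and definiens only so that the refutation below (which closed the item
`refuted` at e3ca7d8cf07a; append-only statement text) keeps elaborating after the route's
`restate` dropped the constant from `Theses/BECPopovBerryRG.lean`. FALSE, see below. -/
def _root_.Summit.AtomisticToContinuum.BoseEinsteinCondensation.Theses.BECPopovBerryRG.BerryStiffPhaseLRO :
    Prop :=
  ∀ Λ : ℝ, 1 ≤ Λ → ∀ R : ℕ, ∃ ε₀ K₀ C : ℝ, 0 < ε₀ ∧ 0 < K₀ ∧ 0 < C ∧ ∀ K : ℝ, K₀ ≤ K →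
    ∀ m n : ℕ, ∀ Kd : Fin 4 → ℝ, (∀ i, K ≤ Kd i ∧ Kd i ≤ Λ * K) → ∀ δ : ℝ, |δ| ≤ 1 / 2 →
    (∃ z : ℤ, δ * ((m + 2 : ℕ) : ℝ) ^ 3 = (z : ℝ)) → ∀ B : Fin 4 → ℝ → ℂ, (∀ i, Measurable (B i)) → (∀ i η, B i (η + 2 * Real.pi) = B i η) →
    (∀ i : Fin 3, ∀ η, B (Fin.castSucc i) (-η) = B (Fin.castSucc i) η ∧ (B (Fin.castSucc i) η).im = 0) →
    (∀ η, B (Fin.last 3) (-η) = (starRingEnd ℂ) (B (Fin.last 3) η)) →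
    (∀ i η, |η| ≤ 1 / (4 * Λ) → ∃ u : ℂ, ‖u‖ ≤ K * η ^ 2 * (ε₀ * |η| + Λ * η ^ 2) ∧
      B i η = Complex.exp (((-(Kd i * η ^ 2 / 2) : ℝ) : ℂ) +
        ((if i = Fin.last 3 then δ * η else 0 : ℝ) : ℂ) * Complex.I + u)) →
    (∀ i η, |η| ≤ Real.pi → ‖B i η‖ ≤ 2 * Real.exp (-(K * (1 - Real.cos η) / 2))) →
    let near : ((Fin 3 → Fin (m + 2)) × Fin (n + 2)) → ((Fin 3 → Fin (m + 2)) × Fin (n + 2)) → Prop :=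
      fun x y => (∀ i, ((y.1 i - x.1 i : Fin (m + 2)) : ℕ) ≤ R ∨ ((x.1 i - y.1 i : Fin (m + 2)) : ℕ) ≤ R) ∧
        (((y.2 - x.2 : Fin (n + 2)) : ℕ) ≤ R ∨ ((x.2 - y.2 : Fin (n + 2)) : ℕ) ≤ R);
    let e : ((Fin 3 → Fin (m + 2)) × Fin (n + 2)) → (((Fin 3 → Fin (m + 2)) × Fin (n + 2)) → ℝ) → ℝ :=
      fun s θ => (∑ i : Fin 3, (1 - Real.cos (θ (s.1 + Pi.single i 1, s.2) - θ s))) +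
        (1 - Real.cos (θ (s.1, s.2 + 1) - θ s));
    ∀ w : ((Fin 3 → Fin (m + 2)) × Fin (n + 2)) → (((Fin 3 → Fin (m + 2)) × Fin (n + 2)) → ℝ) → ℂ,
    (∀ x, Measurable (w x)) → (∀ x θ y, w x (θ + Pi.single y (2 * Real.pi)) = w x θ) → (∀ x θ θ', (∀ y, near x y → θ y = θ' y) → w x θ = w x θ') →
    (∀ x θ, ‖w x θ‖ ≤ ε₀ * K * ∑ y, if near x y then e y θ else 0) →
    ∀ g : Finset ((Fin 3 → Fin (m + 2)) × Fin (n + 2)) → (((Fin 3 → Fin (m + 2)) × Fin (n + 2)) → ℝ) → ℂ,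
    (∀ F, Measurable (g F)) → (∀ θ, g ∅ θ = 1) → (∀ F θ θ', (∀ y, (∃ x ∈ F, near x y) → θ y = θ' y) → g F θ = g F θ') →
    (∀ F θ, ‖g F θ‖ ≤ Real.exp (-(K * F.card))) →
    let wt : (((Fin 3 → Fin (m + 2)) × Fin (n + 2)) → ℝ) → ℂ := fun θ =>
      ∑ F : Finset ((Fin 3 → Fin (m + 2)) × Fin (n + 2)), g F θ *
        (∏ s : ((Fin 3 → Fin (m + 2)) × Fin (n + 2)),
          (∏ i : Fin 3, if s ∉ F ∧ (s.1 + Pi.single i 1, s.2) ∉ F then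
            B (Fin.castSucc i) (θ (s.1 + Pi.single i 1, s.2) - θ s) else 1) *
          (if s ∉ F ∧ (s.1, s.2 + 1) ∉ F then B (Fin.last 3) (θ (s.1, s.2 + 1) - θ s) else 1)) *
        Complex.exp (-∑ x ∈ Fᶜ, w x θ);
    let Z : ℂ := ∫ θ in Set.pi Set.univ (fun _ : ((Fin 3 → Fin (m + 2)) × Fin (n + 2)) => Set.Ico (0 : ℝ) (2 * Real.pi)), wt θ;
    Z ≠ 0 ∧ ∀ x y : ((Fin 3 → Fin (m + 2)) × Fin (n + 2)), x.2 = y.2 →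
      ∀ O P : (((Fin 3 → Fin (m + 2)) × Fin (n + 2)) → ℝ) → ℂ, Measurable O → Measurable P →
      (∀ θ θ', (∀ s, near x s → θ s = θ' s) → O θ = O θ') → (∀ θ θ', (∀ s, near y s → θ s = θ' s) → P θ = P θ') →
      (∀ θ, ‖O θ - 1‖ ≤ ∑ s, if near x s then Real.sqrt (e s θ) else 0) →
      (∀ θ, ‖P θ - 1‖ ≤ ∑ s, if near y s then Real.sqrt (e s θ) else 0) →
      ‖(∫ θ in Set.pi Set.univ (fun _ : ((Fin 3 → Fin (m + 2)) × Fin (n + 2)) => Set.Ico (0 : ℝ) (2 * Real.pi)), (Real.cos (θ x - θ y) : ℂ) * O θ * P θ * wt θ) - Z‖ ≤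
        C / Real.sqrt K * ‖Z‖

/-- Refutes `BECPopovBerryRG.BerryStiffPhaseLRO` = stmt-AtomisticToContinuum-14490 (re-declared
above, see the module docstring) [refuted-misstated]: the engine's large-field
activities `g : Finset sites → (config → ℂ)` are constrained only by `g ∅ = 1`, locality and
`‖g_F‖ ≤ e^{-K|F|}` — no factorisation over connected components — so once the volume
`V = (m+2)³(n+2)` exceeds `e^{K}` the admissible family `g_∅ = 1`, `g_{x} ≡ -Z_∅/Σ_yΨ_y` on
singletons, `g_F = 0` otherwise (cosine bonds `e^{-K(1-cos η)}` in all four directions, `δ = 0`,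
`w ≡ 0`, `Λ = 1`, `R = 0`) has `Z = ∫ wt = Z_∅ - (Z_∅/ΣΨ)·ΣΨ = 0`, contradicting `Z ≠ 0`;
witness volume `m = 0`, `n = ⌈e^{K₀}⌉`, `K = K₀`. Repaired statement `C′`: require
`g_F = Π_{γ ∈ R-components(F)} g_γ` (polymer factorisation, each `g_γ` local with
`‖g_γ‖ ≤ e^{-K|γ|}`); the witness does not factorise and misses `C′`. [folklore] -/
theorem BECPopovBerryRGBerryStiffPhaseLRO_refuted :
    ¬ Summit.AtomisticToContinuum.BoseEinsteinCondensation.Theses.BECPopovBerryRG.BerryStiffPhaseLRO := by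
  intro h
  obtain ⟨ε₀, K₀, C, hε₀, hK₀, -, h⟩ := h 1 le_rfl 0
  /- 1. The cosine bond `b η = e^{-K₀(1 - cos η)}`: `0 < b ≤ 1`, continuous. -/
  have hb0 : ∀ η : ℝ, 0 < Real.exp (-(K₀ * (1 - Real.cos η))) := fun η => Real.exp_pos _
  have hb1 : ∀ η : ℝ, Real.exp (-(K₀ * (1 - Real.cos η))) ≤ 1 := fun η =>
    Real.exp_le_one_iff.2 (neg_nonpos.2 (mul_nonneg hK₀.le (sub_nonneg.2 (Real.cos_le_one _))))
  have hbc : Continuous fun η : ℝ => Real.exp (-(K₀ * (1 - Real.cos η))) := by fun_prop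
  have hite0 : ∀ (p : Prop) [Decidable p] (η : ℝ),
      0 ≤ (if p then Real.exp (-(K₀ * (1 - Real.cos η))) else 1) := by
    intro p _ η
    split_ifs
    · exact (hb0 η).le
    · exact zero_le_one
  have hite1 : ∀ (p : Prop) [Decidable p] (η : ℝ),
      (if p then Real.exp (-(K₀ * (1 - Real.cos η))) else 1) ≤ 1 := by
    intro p _ η
    split_ifs
    · exact hb1 η
    · exact le_rfl
  /- 2. The core computation on an arbitrary torus `(ℤ/(m+2))³ × ℤ/(n+2)` of volume `≥ e^{K₀}`:
     an admissible `c ∈ [0, e^{-K₀}]` for which the witness partition function vanishes. -/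
  have core : ∀ m n : ℕ,
      Real.exp K₀ ≤ (Fintype.card ((Fin 3 → Fin (m + 2)) × Fin (n + 2)) : ℝ) →
      ∃ c : ℝ, 0 ≤ c ∧ c ≤ Real.exp (-K₀) ∧
        (∫ θ in Set.pi Set.univ
            (fun _ : (Fin 3 → Fin (m + 2)) × Fin (n + 2) => Set.Ico (0 : ℝ) (2 * Real.pi)),
          ∑ F : Finset ((Fin 3 → Fin (m + 2)) × Fin (n + 2)),
            (((if F.card = 0 then 1 else if F.card = 1 then -c else 0 : ℝ)) : ℂ) *
            (∏ s : (Fin 3 → Fin (m + 2)) × Fin (n + 2),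
              (∏ i : Fin 3, if s ∉ F ∧ (s.1 + Pi.single i 1, s.2) ∉ F then
                ((Real.exp (-(K₀ * (1 - Real.cos (θ (s.1 + Pi.single i 1, s.2) - θ s)))) : ℝ) : ℂ)
                else 1) *
              (if s ∉ F ∧ (s.1, s.2 + 1) ∉ F then
                ((Real.exp (-(K₀ * (1 - Real.cos (θ (s.1, s.2 + 1) - θ s)))) : ℝ) : ℂ)
                else 1))) = 0 := by
    intro m n hV
    -- the real bond product with the bonds touching `F` deleted
    set P : Finset ((Fin 3 → Fin (m + 2)) × Fin (n + 2)) →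
        (((Fin 3 → Fin (m + 2)) × Fin (n + 2)) → ℝ) → ℝ := fun F θ =>
      ∏ s : (Fin 3 → Fin (m + 2)) × Fin (n + 2),
        ((∏ i : Fin 3, if s ∉ F ∧ (s.1 + Pi.single i 1, s.2) ∉ F then
            Real.exp (-(K₀ * (1 - Real.cos (θ (s.1 + Pi.single i 1, s.2) - θ s)))) else 1) *
          (if s ∉ F ∧ (s.1, s.2 + 1) ∉ F then
            Real.exp (-(K₀ * (1 - Real.cos (θ (s.1, s.2 + 1) - θ s)))) else 1)) with hP
    -- the box `[0, 2π)^{sites}`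
    set box : Set (((Fin 3 → Fin (m + 2)) × Fin (n + 2)) → ℝ) :=
      Set.pi Set.univ (fun _ => Set.Ico (0 : ℝ) (2 * Real.pi)) with hbox
    have hbox_meas : MeasurableSet box := MeasurableSet.univ_pi fun _ => measurableSet_Ico
    have hbox_fin : volume box ≠ ⊤ := by
      rw [hbox, volume_pi_pi]
      simp only [Real.volume_Ico, sub_zero, Finset.prod_const]
      exact ENNReal.pow_ne_top ENNReal.ofReal_ne_top
    have hP0 : ∀ F θ, 0 ≤ P F θ := fun F θ =>
      Finset.prod_nonneg fun _ _ =>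
        mul_nonneg (Finset.prod_nonneg fun _ _ => hite0 _ _) (hite0 _ _)
    have hP1 : ∀ F θ, P F θ ≤ 1 := fun F θ =>
      Finset.prod_le_one
        (fun _ _ => mul_nonneg (Finset.prod_nonneg fun _ _ => hite0 _ _) (hite0 _ _))
        fun _ _ => mul_le_one₀ (Finset.prod_le_one (fun _ _ => hite0 _ _) fun _ _ => hite1 _ _)
          (hite0 _ _) (hite1 _ _)
    -- deleting bonds can only increase the product
    have hmono : ∀ F θ, P ∅ θ ≤ P F θ := by
      intro F θ
      simp only [hP]
      refine Finset.prod_le_prod (fun s _ => mul_nonneg (Finset.prod_nonneg fun i _ =>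
        hite0 _ _) (hite0 _ _)) fun s _ => ?_
      refine mul_le_mul (Finset.prod_le_prod (fun i _ => hite0 _ _) fun i _ => ?_) ?_
        (hite0 _ _) (Finset.prod_nonneg fun i _ => hite0 _ _)
      · simp only [Finset.notMem_empty, not_false_eq_true, and_self, if_true]
        split_ifs
        · exact le_rfl
        · exact hb1 _
      · simp only [Finset.notMem_empty, not_false_eq_true, and_self, if_true]
        split_ifs
        · exact le_rfl
        · exact hb1 _
    have hcont : ∀ F, Continuous (P F) := by
      intro F
      simp only [hP]
      refine continuous_finsetProd _ fun s _ => ?_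
      refine Continuous.mul (continuous_finsetProd _ fun i _ => ?_) ?_
      · by_cases hc : s ∉ F ∧ (s.1 + Pi.single i 1, s.2) ∉ F
        · simp only [hc, not_false_eq_true, and_self, if_true]
          exact hbc.comp ((continuous_apply _).sub (continuous_apply _))
        · simp only [hc, if_false]
          exact continuous_const
      · by_cases hc : s ∉ F ∧ (s.1, s.2 + 1) ∉ F
        · simp only [hc, not_false_eq_true, and_self, if_true]
          exact hbc.comp ((continuous_apply _).sub (continuous_apply _))
        · simp only [hc, if_false]
          exact continuous_const
    have hint : ∀ F, IntegrableOn (P F) box volume := fun F =>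
      Measure.integrableOn_of_bounded (M := 1) hbox_fin (hcont F).aestronglyMeasurable
        (ae_of_all _ fun θ => by
          rw [Real.norm_eq_abs, abs_of_nonneg (hP0 F θ)]
          exact hP1 F θ)
    -- the clean partition function and the deleted-site integrals
    set Z0 : ℝ := ∫ θ in box, P ∅ θ with hZ0
    set Ψ : ((Fin 3 → Fin (m + 2)) × Fin (n + 2)) → ℝ := fun x => ∫ θ in box, P {x} θ with hΨ
    have hZ0_nonneg : 0 ≤ Z0 := setIntegral_nonneg hbox_meas fun θ _ => hP0 ∅ θ
    have hZ0_le : ∀ x, Z0 ≤ Ψ x := fun x =>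
      setIntegral_mono (hint ∅) (hint {x}) fun θ => hmono {x} θ
    have hΨ_nonneg : ∀ x, 0 ≤ Ψ x := fun x => hZ0_nonneg.trans (hZ0_le x)
    have hsum_nonneg : 0 ≤ ∑ x, Ψ x := Finset.sum_nonneg fun x _ => hΨ_nonneg x
    have hsum_ge : (Fintype.card ((Fin 3 → Fin (m + 2)) × Fin (n + 2)) : ℝ) * Z0 ≤ ∑ x, Ψ x := by
      calc (Fintype.card ((Fin 3 → Fin (m + 2)) × Fin (n + 2)) : ℝ) * Z0
            = ∑ _x : (Fin 3 → Fin (m + 2)) × Fin (n + 2), Z0 := by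
            rw [Finset.sum_const, nsmul_eq_mul, Finset.card_univ]
        _ ≤ ∑ x, Ψ x := Finset.sum_le_sum fun x _ => hZ0_le x
    have hVpos : (0 : ℝ) < Fintype.card ((Fin 3 → Fin (m + 2)) × Fin (n + 2)) :=
      (Real.exp_pos K₀).trans_le hV
    -- the real identity `Z0 - c ΣΨ = 0`
    have hreal : Z0 - Z0 / (∑ x, Ψ x) * ∑ x, Ψ x = 0 := by
      rcases hsum_nonneg.eq_or_lt with hs | hs
      · have hZ : Z0 ≤ 0 := by
          have := hsum_ge
          rw [← hs] at this
          nlinarith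
        have hZ' : Z0 = 0 := le_antisymm hZ hZ0_nonneg
        rw [hZ', zero_div, zero_mul, sub_zero]
      · rw [div_mul_cancel₀ _ hs.ne', sub_self]
    -- the activity-weighted sum collapses to `Q ∅ - c Σ_x Q {x}`
    have hsumg : ∀ (c : ℝ) (Q : Finset ((Fin 3 → Fin (m + 2)) × Fin (n + 2)) → ℂ),
        ∑ F, (((if F.card = 0 then 1 else if F.card = 1 then -c else 0 : ℝ)) : ℂ) * Q F =
          Q ∅ - c * ∑ x, Q {x} := by
      intro c Q
      have key : ∀ F : Finset ((Fin 3 → Fin (m + 2)) × Fin (n + 2)),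
          (((if F.card = 0 then 1 else if F.card = 1 then -c else 0 : ℝ)) : ℂ) * Q F =
            (if F = ∅ then Q ∅ else 0) + ∑ x, (if F = {x} then -(c : ℂ) * Q {x} else 0) := by
        intro F
        by_cases h0 : F = ∅
        · subst h0
          have hne : ∀ x : (Fin 3 → Fin (m + 2)) × Fin (n + 2),
              (∅ : Finset ((Fin 3 → Fin (m + 2)) × Fin (n + 2))) ≠ {x} :=
            fun x => (Finset.singleton_ne_empty x).symm
          simp [hne]
        · by_cases h1 : F.card = 1
          · obtain ⟨a, rfl⟩ := Finset.card_eq_one.1 h1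
            have hs : ∀ x : (Fin 3 → Fin (m + 2)) × Fin (n + 2),
                (({a} : Finset ((Fin 3 → Fin (m + 2)) × Fin (n + 2))) = {x}) ↔ (x = a) :=
              fun x => by rw [Finset.singleton_inj]; exact eq_comm
            simp only [Finset.card_singleton, one_ne_zero, if_false, if_true, h0, hs,
              Finset.sum_ite_eq', Finset.mem_univ, zero_add]
            push_cast
            ring
          · have hc0 : F.card ≠ 0 := by rwa [Ne, Finset.card_eq_zero]
            have hne : ∀ x : (Fin 3 → Fin (m + 2)) × Fin (n + 2), F ≠ {x} :=
              fun x hx => h1 (by rw [hx, Finset.card_singleton])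
            simp [h0, h1, hc0, hne]
      simp_rw [key]
      rw [Finset.sum_add_distrib, Finset.sum_ite_eq', Finset.sum_comm]
      simp only [Finset.mem_univ, if_true, Finset.sum_ite_eq', Finset.mul_sum]
      simp only [Finset.sum_neg_distrib, neg_mul, sub_eq_add_neg]
    refine ⟨Z0 / ∑ x, Ψ x, div_nonneg hZ0_nonneg hsum_nonneg, ?_, ?_⟩
    · -- admissibility `c ≤ e^{-K₀}`
      rcases hZ0_nonneg.eq_or_lt with h0 | hpos
      · rw [← h0, zero_div]
        exact (Real.exp_pos _).le
      · have hS : 0 < ∑ x, Ψ x := (mul_pos hVpos hpos).trans_le hsum_ge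
        rw [div_le_iff₀ hS, Real.exp_neg]
        calc Z0 = (Fintype.card ((Fin 3 → Fin (m + 2)) × Fin (n + 2)) : ℝ)⁻¹ *
              ((Fintype.card ((Fin 3 → Fin (m + 2)) × Fin (n + 2)) : ℝ) * Z0) := by
              field_simp
          _ ≤ (Fintype.card ((Fin 3 → Fin (m + 2)) × Fin (n + 2)) : ℝ)⁻¹ * ∑ x, Ψ x :=
              mul_le_mul_of_nonneg_left hsum_ge (inv_nonneg.2 hVpos.le)
          _ ≤ (Real.exp K₀)⁻¹ * ∑ x, Ψ x :=
              mul_le_mul_of_nonneg_right (inv_anti₀ (Real.exp_pos K₀) hV) hsum_nonneg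
    · -- the integral vanishes
      have hcast : ∀ (F : Finset ((Fin 3 → Fin (m + 2)) × Fin (n + 2)))
          (θ : ((Fin 3 → Fin (m + 2)) × Fin (n + 2)) → ℝ),
          (∏ s : (Fin 3 → Fin (m + 2)) × Fin (n + 2),
              (∏ i : Fin 3, if s ∉ F ∧ (s.1 + Pi.single i 1, s.2) ∉ F then
                ((Real.exp (-(K₀ * (1 - Real.cos (θ (s.1 + Pi.single i 1, s.2) - θ s)))) : ℝ) : ℂ)
                else 1) *
              (if s ∉ F ∧ (s.1, s.2 + 1) ∉ F then
                ((Real.exp (-(K₀ * (1 - Real.cos (θ (s.1, s.2 + 1) - θ s)))) : ℝ) : ℂ)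
                else 1)) = ((P F θ : ℝ) : ℂ) := by
        intro F θ
        simp only [hP, Complex.ofReal_prod, Complex.ofReal_mul, apply_ite Complex.ofReal,
          Complex.ofReal_one]
      have hpt : ∀ θ : ((Fin 3 → Fin (m + 2)) × Fin (n + 2)) → ℝ,
          (∑ F : Finset ((Fin 3 → Fin (m + 2)) × Fin (n + 2)),
            (((if F.card = 0 then 1 else if F.card = 1 then -(Z0 / ∑ x, Ψ x) else 0 : ℝ)) : ℂ) *
            (∏ s : (Fin 3 → Fin (m + 2)) × Fin (n + 2),
              (∏ i : Fin 3, if s ∉ F ∧ (s.1 + Pi.single i 1, s.2) ∉ F then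
                ((Real.exp (-(K₀ * (1 - Real.cos (θ (s.1 + Pi.single i 1, s.2) - θ s)))) : ℝ) : ℂ)
                else 1) *
              (if s ∉ F ∧ (s.1, s.2 + 1) ∉ F then
                ((Real.exp (-(K₀ * (1 - Real.cos (θ (s.1, s.2 + 1) - θ s)))) : ℝ) : ℂ)
                else 1))) =
          (((P ∅ θ - (Z0 / ∑ x, Ψ x) * ∑ x, P {x} θ : ℝ)) : ℂ) := by
        intro θ
        simp_rw [hcast]
        rw [hsumg]
        push_cast
        ring
      have hint_sum : Integrable (fun θ => (Z0 / ∑ x, Ψ x) * ∑ x, P {x} θ)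
          (volume.restrict box) :=
        (integrable_finsetSum _ fun x _ => hint {x}).const_mul _
      have hΨsum : ∫ θ in box, ∑ x, P {x} θ = ∑ x, Ψ x :=
        integral_finsetSum _ fun x _ => hint {x}
      rw [setIntegral_congr_fun hbox_meas (fun θ _ => hpt θ), integral_complex_ofReal,
        integral_sub (hint ∅) hint_sum, integral_const_mul, hΨsum, hreal, Complex.ofReal_zero]
  /- 3. The volume: `m = 0`, `n = ⌈e^{K₀}⌉`, so `V = 8(n+2) ≥ e^{K₀}`. -/
  set n : ℕ := ⌈Real.exp K₀⌉₊ with hn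
  have hV : Real.exp K₀ ≤ (Fintype.card ((Fin 3 → Fin (0 + 2)) × Fin (n + 2)) : ℝ) := by
    calc Real.exp K₀ ≤ (n : ℝ) := Nat.le_ceil _
      _ ≤ (Fintype.card ((Fin 3 → Fin (0 + 2)) × Fin (n + 2)) : ℝ) := by
          have : n ≤ Fintype.card ((Fin 3 → Fin (0 + 2)) × Fin (n + 2)) := by
            simp only [Fintype.card_prod, Fintype.card_fun, Fintype.card_fin]
            nlinarith
          exact_mod_cast this
  obtain ⟨c, hc0, hc1, hcore⟩ := core 0 n hV
  /- 4. The bond factors are members of the engine class. -/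
  set B : Fin 4 → ℝ → ℂ := fun _ η => ((Real.exp (-(K₀ * (1 - Real.cos η))) : ℝ) : ℂ) with hB
  have hBmeas : ∀ i, Measurable (B i) := fun i =>
    (Complex.continuous_ofReal.comp hbc).measurable
  have hBper : ∀ i η, B i (η + 2 * Real.pi) = B i η := by
    intro i η
    show ((Real.exp (-(K₀ * (1 - Real.cos (η + 2 * Real.pi)))) : ℝ) : ℂ) =
      ((Real.exp (-(K₀ * (1 - Real.cos η))) : ℝ) : ℂ)
    rw [Real.cos_add_two_pi]
  have hBeven : ∀ i : Fin 3, ∀ η, B (Fin.castSucc i) (-η) = B (Fin.castSucc i) η ∧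
      (B (Fin.castSucc i) η).im = 0 := by
    intro i η
    show ((Real.exp (-(K₀ * (1 - Real.cos (-η)))) : ℝ) : ℂ) =
        ((Real.exp (-(K₀ * (1 - Real.cos η))) : ℝ) : ℂ) ∧
      (((Real.exp (-(K₀ * (1 - Real.cos η))) : ℝ) : ℂ)).im = 0
    refine ⟨?_, Complex.ofReal_im _⟩
    rw [Real.cos_neg]
  have hBconj : ∀ η, B (Fin.last 3) (-η) = (starRingEnd ℂ) (B (Fin.last 3) η) := by
    intro η
    show ((Real.exp (-(K₀ * (1 - Real.cos (-η)))) : ℝ) : ℂ) =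
      (starRingEnd ℂ) (((Real.exp (-(K₀ * (1 - Real.cos η))) : ℝ) : ℂ))
    rw [Complex.conj_ofReal, Real.cos_neg]
  have hBcore : ∀ (i : Fin 4) (η : ℝ), |η| ≤ 1 / (4 * 1) → ∃ u : ℂ,
      ‖u‖ ≤ K₀ * η ^ 2 * (ε₀ * |η| + 1 * η ^ 2) ∧
        B i η = Complex.exp ((((-((fun _ : Fin 4 => K₀) i * η ^ 2 / 2)) : ℝ) : ℂ) +
          ((if i = Fin.last 3 then 0 * η else 0 : ℝ) : ℂ) * Complex.I + u) := by
    intro i η hη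
    refine ⟨((K₀ * (η ^ 2 / 2 - (1 - Real.cos η)) : ℝ) : ℂ), ?_, ?_⟩
    · rw [Complex.norm_real, Real.norm_eq_abs, abs_mul, abs_of_pos hK₀]
      have h1 : |η| ≤ 1 := hη.trans (by norm_num)
      have hcb := Real.cos_bound h1
      have h2 : |η ^ 2 / 2 - (1 - Real.cos η)| = |Real.cos η - (1 - η ^ 2 / 2)| := by
        congr 1; ring
      have h4 : |η| ^ 4 = η ^ 2 * η ^ 2 := by
        rw [show (4 : ℕ) = 2 * 2 from rfl, pow_mul, sq_abs]; ring
      rw [h2]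
      rw [h4] at hcb
      have h5 : 0 ≤ K₀ * η ^ 2 * (ε₀ * |η|) := by positivity
      nlinarith [sq_nonneg η, hK₀.le]
    · have hite : (if i = Fin.last 3 then (0 : ℝ) * η else 0) = 0 := by
        split_ifs <;> ring
      rw [hite]
      simp only [hB, Complex.ofReal_exp]
      congr 1
      push_cast
      ring
  have hBfloor : ∀ (i : Fin 4) (η : ℝ), |η| ≤ Real.pi →
      ‖B i η‖ ≤ 2 * Real.exp (-(K₀ * (1 - Real.cos η) / 2)) := by
    intro i η _
    show ‖(((Real.exp (-(K₀ * (1 - Real.cos η))) : ℝ) : ℂ))‖ ≤ _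
    rw [Complex.norm_real, Real.norm_eq_abs, abs_of_pos (hb0 η)]
    have h0 : 0 ≤ K₀ * (1 - Real.cos η) := mul_nonneg hK₀.le (sub_nonneg.2 (Real.cos_le_one _))
    calc Real.exp (-(K₀ * (1 - Real.cos η))) ≤ Real.exp (-(K₀ * (1 - Real.cos η) / 2)) :=
          Real.exp_le_exp.2 (by linarith)
      _ ≤ 2 * Real.exp (-(K₀ * (1 - Real.cos η) / 2)) := by
          linarith [Real.exp_pos (-(K₀ * (1 - Real.cos η) / 2))]
  have h2 := h K₀ le_rfl 0 n (fun _ => K₀) (fun _ => ⟨le_rfl, by rw [one_mul]⟩) 0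
    (by norm_num) ⟨0, by simp⟩ B hBmeas hBper hBeven hBconj hBcore hBfloor
  /- 5. The remainder `w ≡ 0` and the witness activities; the engine's `Z ≠ 0` fails. -/
  have hgbound : ∀ F : Finset ((Fin 3 → Fin (0 + 2)) × Fin (n + 2)),
      ‖(((if F.card = 0 then 1 else if F.card = 1 then -c else 0 : ℝ)) : ℂ)‖ ≤
        Real.exp (-(K₀ * F.card)) := by
    intro F
    rw [Complex.norm_real, Real.norm_eq_abs]
    by_cases h0 : F.card = 0
    · simp [h0]
    · by_cases h1 : F.card = 1
      · rw [if_neg h0, if_pos h1, abs_neg, abs_of_nonneg hc0, h1, Nat.cast_one, mul_one]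
        exact hc1
      · simp only [h0, h1, if_false, abs_zero]
        exact (Real.exp_pos _).le
  have h3 := h2 (fun _ _ => 0) (fun _ => measurable_const) (fun _ _ _ => rfl)
    (fun _ _ _ _ => rfl)
    (by
      intro x θ
      rw [norm_zero]
      refine mul_nonneg (mul_nonneg hε₀.le hK₀.le) (Finset.sum_nonneg fun y _ => ?_)
      split_ifs
      · exact add_nonneg (Finset.sum_nonneg fun i _ => sub_nonneg.2 (Real.cos_le_one _))
          (sub_nonneg.2 (Real.cos_le_one _))
      · exact le_rfl)
    (fun F _ => (((if F.card = 0 then 1 else if F.card = 1 then -c else 0 : ℝ)) : ℂ))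
    (fun _ => measurable_const) (fun θ => by simp) (fun _ _ _ _ => rfl) (fun F _ => hgbound F)
  obtain ⟨hZ, -⟩ := h3
  apply hZ
  simp only [Finset.sum_const_zero, neg_zero, Complex.exp_zero, mul_one]
  exact hcore

end Summit.AtomisticToContinuum.BoseEinsteinCondensation.Theorems
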